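import Mathlib.NumberTheory.LSeries.Basic
import Mathlib.NumberTheory.LSeries.RiemannZeta
import Mathlib.NumberTheory.LSeries.DirichletContinuation
import Mathlib.Analysis.SpecialFunctions.Gamma.Basic
import Mathlib.Analysis.SpecialFunctions.Pow.Complex
import Mathlib.Algebra.IsPrimePow
import HarnessLib
import HarnessLib.Audit

-- provenance: harness21/H21/H21/Prelude/AntSieve/SelbergClass.lean @ 93a4f70 (interim HEAD d8f2665); M5 mechanical rewrite
/-!
# The Selberg class (AntSieve trunk, prelude C8)

The *Selberg class* `𝒮` (Selberg 1992) is the class of Dirichlet series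
`F(s) = ∑ a(n) n⁻ˢ`, absolutely convergent for `re s > 1`, satisfying

1. (Ramanujan) `a(n) ≪_ε n^ε`;
2. (analytic continuation) `(s - 1)^m F(s)` extends to an entire function of finite order for
   some `m : ℕ`;
3. (functional equation) with `Φ(s) = Q^s ∏ⱼ Γ(λⱼ s + μⱼ) F(s)` (`Q > 0`, `λⱼ > 0`, `re μⱼ ≥ 0`)
   one has `Φ(s) = ω · conj (Φ (1 - conj s))` with `‖ω‖ = 1`;
4. (Euler product) `log F(s) = ∑ b(n) n⁻ˢ` with `b` supported on prime powers and
   `b(n) ≪ n^θ` for some `θ < 1/2`.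

## Design (outline D-ANT-6)

* `Literature.NumberTheory.LFunctions.SelbergDatum` bundles the coefficients, the function *and one choice* of functional-equation
  data `(Q, λ, μ, ω)` as data (not under `∃`), so that `degree = 2 ∑ λⱼ` and the conductor are
  honest definitions. Independence of the degree from the chosen data is the theorem
  `SelbergDatum.degree_eq_of_toFun_eq` (Conrey–Ghosh 1993).
* `IsInSelbergClass F := ∃ D : SelbergDatum, D.toFun = F` and
  `SelbergGrandRiemannHypothesis := ∀ D, D.RiemannHypothesis` (strip form, D-ANT-5).
* There is no `coeff_zero` field: Mathlib's `LSeries` ignores the term `n = 0`.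
* Pointwise conventions. Mathlib functions are total (`riemannZeta 1`, `Complex.Gamma (-n) = 0` are
  junk values), so two axioms are phrased to be insensitive to junk values:
  the continuation axiom asks for an entire `G` agreeing with `(s - 1)^m F(s)` on `s ≠ 1`
  (for `ζ` with `m = 1` the pointwise product is `0` at `s = 1` while the limit is `1`), and the
  functional equation is required on the open critical strip `0 < re s < 1` only, where all
  gamma factors are pole-free and `F` is holomorphic; by the identity theorem this is equivalent
  to the usual meromorphic identity.
* No `def zetaDatum : SelbergDatum` is built (it would need analytic proofs inside a definition);
  membership of `ζ` and of primitive Dirichlet `L`-functions is recorded as `∃` theorems.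
* Mathlib has no Selberg class (`Mathlib/NumberTheory/SelbergSieve.lean` is unrelated); we use
  Mathlib's `LSeries`, `LSeriesSummable`, `Complex.Gamma`, `riemannZeta`, `RiemannHypothesis`,
  `DirichletCharacter.LFunction`, `DirichletCharacter.IsPrimitive`, `IsPrimePow`.

## References

* A. Selberg, *Old and new conjectures and results about a class of Dirichlet series*,
  Proc. Amalfi Conference on Analytic Number Theory (1989), Salerno 1992, 367–385.
* J. B. Conrey, A. Ghosh, *On the Selberg class of Dirichlet series: small degrees*,
  Duke Math. J. **72** (1993), 673–693.
* J. Kaczorowski, A. Perelli, *The Selberg class: a survey*, in: Number Theory in Progress,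
  de Gruyter 1999, 953–992.
-/

noncomputable section

open Complex Filter Asymptotics
open scoped ComplexConjugate

namespace Literature.NumberTheory.LFunctions

/-- A *Selberg datum*: an element `F` of the Selberg class `𝒮` together with a chosen set of
functional-equation parameters `(Q, λⱼ, μⱼ, ω)` (Selberg 1992, §1; Kaczorowski–Perelli survey, §1).
The fields are: Dirichlet coefficients `coeff`, the function `toFun : ℂ → ℂ`, the polar order `m`
at `s = 1`, `Q > 0`, gamma-factor parameters `λⱼ > 0`, `re μⱼ ≥ 0`, and the root number `ω`,
`‖ω‖ = 1`; the axioms are Selberg's (i)–(v). See the module docstring for the pointwise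
conventions in `differentiable` and `functional_equation`. [cite: Selberg1992, §1] -/
structure SelbergDatum where
  /-- The Dirichlet coefficients `a(n)` (the value at `0` is irrelevant). -/
  coeff : ℕ → ℂ
  /-- The `L`-function `F : ℂ → ℂ` (its continuation to all of `ℂ`; the value at the possible
  pole `s = 1` is unconstrained). -/
  toFun : ℂ → ℂ
  /-- An integer `m` such that `(s - 1)^m F(s)` is entire. -/
  polarOrder : ℕ
  /-- The parameter `Q > 0` of the functional equation. -/
  Q : ℝ
  /-- The number of gamma factors. -/
  numGamma : ℕ
  /-- The parameters `λⱼ > 0` of the gamma factors `Γ(λⱼ s + μⱼ)`. -/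
  lam : Fin numGamma → ℝ
  /-- The parameters `μⱼ`, `re μⱼ ≥ 0`, of the gamma factors `Γ(λⱼ s + μⱼ)`. -/
  mu : Fin numGamma → ℂ
  /-- The root number `ω`, `‖ω‖ = 1`. -/
  rootNumber : ℂ
  /-- Normalisation `a(1) = 1`. -/
  coeff_one : coeff 1 = 1
  /-- Ramanujan hypothesis: `a(n) ≪_ε n^ε` for every `ε > 0`. -/
  ramanujan : ∀ ε : ℝ, 0 < ε → coeff =O[atTop] fun n ↦ (n : ℝ) ^ ε
  /-- `F` agrees with its Dirichlet series on `re s > 1`. -/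
  eqOn_LSeries : Set.EqOn toFun (LSeries coeff) {s | 1 < s.re}
  /-- Analytic continuation: `(s - 1)^m F(s)` extends to an entire function
  (stated via an entire `G` agreeing with it off `s = 1`). -/
  differentiable : ∃ G : ℂ → ℂ, Differentiable ℂ G ∧
    ∀ s, s ≠ 1 → G s = (s - 1) ^ polarOrder * toFun s
  /-- Finite order: `‖(s - 1)^m F(s)‖ ≤ A exp (‖s‖^B)` for `s ≠ 1`. -/
  finiteOrder : ∃ A B : ℝ, ∀ s, s ≠ 1 → ‖(s - 1) ^ polarOrder * toFun s‖ ≤ A * Real.exp (‖s‖ ^ B)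
  /-- `Q > 0`. -/
  Q_pos : 0 < Q
  /-- `λⱼ > 0`. -/
  lam_pos : ∀ j, 0 < lam j
  /-- `re μⱼ ≥ 0`. -/
  mu_re_nonneg : ∀ j, 0 ≤ (mu j).re
  /-- `‖ω‖ = 1`. -/
  norm_rootNumber : ‖rootNumber‖ = 1
  /-- Functional equation `Φ(s) = ω · conj (Φ(1 - conj s))`,
  `Φ(s) = Q^s ∏ⱼ Γ(λⱼ s + μⱼ) F(s)`, on the open critical strip. -/
  functional_equation : ∀ s : ℂ, 0 < s.re → s.re < 1 →
    (Q : ℂ) ^ s * (∏ j, Gamma (lam j * s + mu j)) * toFun s =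
      rootNumber * conj ((Q : ℂ) ^ (1 - conj s) *
        (∏ j, Gamma (lam j * (1 - conj s) + mu j)) * toFun (1 - conj s))
  /-- Euler product: `log F(s) = ∑ b(n) n⁻ˢ` on `re s > 1` with `b` supported on prime powers and
  `b(n) ≪ n^θ` for some `θ < 1/2`. -/
  euler_product : ∃ (b : ℕ → ℂ) (θ : ℝ), θ < 1 / 2 ∧ (∀ n, ¬ IsPrimePow n → b n = 0) ∧
    (b =O[atTop] fun n ↦ (n : ℝ) ^ θ) ∧ ∀ s : ℂ, 1 < s.re → cexp (LSeries b s) = toFun s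

namespace SelbergDatum

variable (D : SelbergDatum)

/-- The gamma factor `γ(s) = Q^s ∏ⱼ Γ(λⱼ s + μⱼ)` of a Selberg datum
(Kaczorowski–Perelli survey, §1). [folklore] -/
def gammaFactor (s : ℂ) : ℂ :=
  (D.Q : ℂ) ^ s * ∏ j, Gamma (D.lam j * s + D.mu j)

/-- The completed function `Φ(s) = Q^s ∏ⱼ Γ(λⱼ s + μⱼ) F(s)` of a Selberg datum
(Selberg 1992, axiom (iii)). [cite: Selberg1992, axiom (iii] -/
def completed (s : ℂ) : ℂ :=
  D.gammaFactor s * D.toFun s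

/-- The degree `d_F = 2 ∑ⱼ λⱼ` of a Selberg datum (Selberg 1992; Conrey–Ghosh 1993, §1). It depends
only on `F`, see `degree_eq_of_toFun_eq`. [cite: Selberg1992] -/
def degree : ℝ :=
  2 * ∑ j, D.lam j

/-- The conductor `q_F = (2π)^{d_F} Q² ∏ⱼ λⱼ^{2λⱼ}` of a Selberg datum
(Kaczorowski–Perelli survey, §2). [folklore] -/
def conductor : ℝ :=
  (2 * Real.pi) ^ D.degree * D.Q ^ 2 * ∏ j, D.lam j ^ (2 * D.lam j)

/-- The Riemann hypothesis for a Selberg datum, in strip form (outline D-ANT-5): every zero of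
`F` in the open critical strip lies on the critical line (Selberg 1992, Conjecture). [cite: Selberg1992, Conjecture] -/
def RiemannHypothesis : Prop :=
  ∀ s : ℂ, D.toFun s = 0 → 0 < s.re → s.re < 1 → s.re = 1 / 2

/-- Unfolding of the completed function `Φ(s) = Q^s ∏ⱼ Γ(λⱼ s + μⱼ) F(s)`
(Selberg 1992, axiom (iii)). [cite: Selberg1992, axiom (iii] -/
lemma completed_apply (s : ℂ) :
    D.completed s = (D.Q : ℂ) ^ s * (∏ j, Gamma (D.lam j * s + D.mu j)) * D.toFun s := rfl

/-- The functional equation in terms of `completed`: `Φ(s) = ω · conj (Φ(1 - conj s))` on the open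
critical strip (Selberg 1992, axiom (iii)). [cite: Selberg1992, axiom (iii] -/
theorem completed_eq (s : ℂ) (hs₀ : 0 < s.re) (hs₁ : s.re < 1) :
    D.completed s = D.rootNumber * conj (D.completed (1 - conj s)) :=
  D.functional_equation s hs₀ hs₁

end SelbergDatum

/-- Membership in the Selberg class `𝒮`: `F : ℂ → ℂ` underlies some Selberg datum
(Selberg 1992, §1). [cite: Selberg1992, §1] -/
def IsInSelbergClass (F : ℂ → ℂ) : Prop :=
  ∃ D : SelbergDatum, D.toFun = F

/-- The **Grand Riemann Hypothesis for the Selberg class**: every `F ∈ 𝒮` satisfies the Riemann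
hypothesis (Selberg 1992, Conjecture; Kaczorowski–Perelli survey, §1). Open. [cite: Selberg1992, Conjecture] -/
@[conjecture] def SelbergGrandRiemannHypothesis : Prop :=
  ∀ D : SelbergDatum, D.RiemannHypothesis

/-! ## API -/

namespace SelbergDatum

variable (D : SelbergDatum)

/-- The degree is an invariant of `F`: two Selberg data with the same function have the same
degree `2 ∑ λⱼ` (Conrey–Ghosh, Duke Math. J. 72 (1993), Thm. 1 remark / §2; via the asymptotics of
the gamma factor). [cite: ConreyGhosh1993, §2] -/
def degree_eq_of_toFun_eq : Prop :=
  ∀ (D₁ D₂ : SelbergDatum) (h : D₁.toFun = D₂.toFun),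
    D₁.degree = D₂.degree

/-- The degree is nonnegative (immediate from `λⱼ > 0`). [folklore] -/
theorem degree_nonneg : 0 ≤ D.degree := by
  unfold degree
  exact mul_nonneg zero_le_two (Finset.sum_nonneg fun j _ ↦ (D.lam_pos j).le)

/-- There are no elements of the Selberg class of degree `0 < d < 1`
(Richert 1957; Conrey–Ghosh, Duke Math. J. 72 (1993), Thm. 1). [cite: Richert1957] -/
def degree_eq_zero_of_lt_one : Prop :=
  ∀ (h : D.degree < 1),
    D.degree = 0

/-- `F(s) ≠ 0` for `re s > 1` (from the Euler product axiom: `F = exp (∑ b(n) n⁻ˢ)` there;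
Selberg 1992, axiom (v)). [cite: Selberg1992, axiom (v] -/
theorem toFun_ne_zero_of_one_lt_re (s : ℂ) (hs : 1 < s.re) : D.toFun s ≠ 0 := by
  obtain ⟨b, θ, -, -, -, h⟩ := D.euler_product
  rw [← h s hs]
  exact Complex.exp_ne_zero _

/-- The Dirichlet series of `F ∈ 𝒮` converges absolutely for `re s > 1` (from the Ramanujan
axiom; Selberg 1992, axiom (i)). [cite: Selberg1992, axiom (i] -/
theorem LSeriesSummable_coeff (s : ℂ) (hs : 1 < s.re) : LSeriesSummable D.coeff s := by
  refine LSeriesSummable_of_isBigO_rpow (x := (s.re - 1) / 2 + 1) (by linarith) ?_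
  have h := D.ramanujan ((s.re - 1) / 2) (by linarith)
  simpa only [add_sub_cancel_right] using h

/-- The completed function `Φ` is holomorphic on `{s | 0 < re s, s ≠ 1}`: there `Q^s` is entire
(`Q > 0`), each `Γ(λⱼ s + μⱼ)` is pole-free (`re (λⱼ s + μⱼ) > 0`) and `F` is holomorphic off
`s = 1` (Kaczorowski–Perelli survey, §1). [cite: KaczorowskiPerelli1999, §1] -/
def differentiableOn_completed : Prop :=
  DifferentiableOn ℂ D.completed {s | 0 < s.re ∧ s ≠ 1}

/-- If the function of a Selberg datum is `ζ`, its strip-form Riemann hypothesis is equivalent to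
Mathlib's `RiemannHypothesis` (the zeros of `ζ` outside the open critical strip are exactly the
trivial zeros; Titchmarsh, *The theory of the Riemann zeta-function*, §2.12 and Thm. 3.1 (no zeros
on `re s = 1`)). [cite: Titchmarsh1986, §2.12 and Thm. 3.1] -/
def riemannHypothesis_iff_of_toFun_eq_riemannZeta : Prop :=
  ∀ (h : D.toFun = riemannZeta),
    D.RiemannHypothesis ↔ _root_.RiemannHypothesis

end SelbergDatum

/-- The Riemann zeta function belongs to the Selberg class, with degree `1` and a simple pole:
one may take `m = 1`, `Q = π^{-1/2}`, one gamma factor `Γ(s/2)` (`λ = 1/2`, `μ = 0`), `ω = 1`,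
and `b(pᵏ) = 1/k` (Selberg 1992, §1; Kaczorowski–Perelli survey, §1, Example 1). Stated as an
existence theorem: a `def` would require the analytic proofs inside a definition. [cite: Selberg1992, §1] -/
def exists_selbergDatum_riemannZeta : Prop :=
  ∃ D : SelbergDatum, D.toFun = riemannZeta ∧ D.degree = 1 ∧ D.polarOrder = 1

/-- The `L`-function of a primitive Dirichlet character of conductor `N > 1` belongs to the Selberg
class, with degree `1` and no pole: `m = 0`, `Q = (N/π)^{1/2}`, one gamma factor `Γ((s + κ)/2)`
(`λ = 1/2`, `μ = κ/2`, `κ ∈ {0, 1}` the parity of `χ`), `ω = τ(χ)/(i^κ √N)`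
(Kaczorowski–Perelli survey, §1, Example 2; Davenport, *Multiplicative Number Theory*, Ch. 9). [cite: KaczorowskiPerelli1999, §1 (examples: Dirichlet L-functions)] -/
def exists_selbergDatum_LFunction : Prop :=
  ∀ {N : ℕ} [NeZero N] (χ : DirichletCharacter ℂ N) (hχ : χ.IsPrimitive) (hN : N ≠ 1),
    ∃ D : SelbergDatum, D.toFun = χ.LFunction ∧ D.degree = 1 ∧ D.polarOrder = 0

/-- The Grand Riemann Hypothesis for the Selberg class implies the (strip-form) Riemann hypothesis
for the `L`-function of every primitive Dirichlet character of conductor `N > 1`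
(via `exists_selbergDatum_LFunction`; Kaczorowski–Perelli survey, §1). The statement is written
out so that this file has no H21 dependencies; the named GRH corollaries live in
`H21/Statements/RH/GeneralizedRH.lean`. [folklore] -/
def SelbergGrandRiemannHypothesis.lFunction_re_eq_one_half : Prop :=
  ∀ {N : ℕ} [NeZero N] (χ : DirichletCharacter ℂ N) (hχ : χ.IsPrimitive) (hN : N ≠ 1),
    SelbergGrandRiemannHypothesis →
      ∀ s : ℂ, χ.LFunction s = 0 → 0 < s.re → s.re < 1 → s.re = 1 / 2

/- interim proof relied on results that are now named facts (D-0014); demoted to a fact by the M5 import, proof preserved: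
:= by
  intro hGRH s hs h₀ h₁
  obtain ⟨D, hD, -, -⟩ := exists_selbergDatum_LFunction χ hχ hN
  exact hGRH D s (by rw [hD]; exact hs) h₀ h₁
-/

end Literature.NumberTheory.LFunctions
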